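import Summits.Ventures.Crystal3D.Theorems.StickyWulffConstantPolycrystalWulffBoundChimeraRuns
import Summits.Ventures.Crystal3D.Theorems.StickyWulffConstantPolycrystalWulffBoundVerticalLamellarChimera

/-!
# `PolycrystalWulffBound`, line `PolyDensity`: the chimera inequality for lamellae cut by parallel planes
# of ARBITRARY inclination, with per-lamella quantile windows (crux `stmt-Ventures-19482`)

Route `StickyWulffConstant` of the venture `Summits/Ventures/Crystal3D`, second prover lane (poly-p2,
gen 8).  Lamellae `G_f = E ∩ {a_f < ⟪x,n⟫ < a_{f+1}}` for ANY unit normal `n` and ANY bodies `K_f`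
(here the crux's `W(A_f)`, no co-axiality used): if `θ_f` are mass fractions (`Σ θ_f = 1`,
`θ_f·V ≤ |G_f|`) and `(lo_f, hi_f)` is a window of heights `⟪·,n⟫` inside `K_f` holding at least the
fraction `θ_f` of `|W| = 32`, then for every measurable `C ⊇ ⋃_f (G_f + r·K_f)`

  `(V^{1/3} + r·32^{1/3})³ ≤ Σ_f |C ∩ {a_f + r·lo_f < ⟪x,n⟫ < a_{f+1} + r·hi_f}|`

(`inclined_chimera_lower`; engine `Chimera.chimera3_runs_pow`).  With CONSECUTIVE quantile windows
(`hi_f`, `lo_{f+1}` the quantiles of the two lamellae's bodies at the same cumulative level) the windows on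
the right overlap only pairwise-consecutively, by heights `r·(hi_f − lo_{f+1})⁺ ≤ r·X` where `X` is the
sup-distance of the two bodies' quantile functions along `n` (seat memo P-TWIN-g8: `X ≤ sin∠(n,m)/√6`
numerically for `W` and its twin `R_m W`); so the right-hand side is `|C| + r·X·(wall sections) + o(r)` —
the Brunn–Minkowski form of the charged-wall estimate.  That last conversion (and the rung) is NOT here.
WHAT THIS IS NOT: a rung; no numerics; the crux is not claimed.
-/

noncomputable section

open scoped BigOperators InnerProductSpace ENNReal Pointwise
open MeasureTheory Set

namespace Summit.Ventures.Crystal3D.Theorems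

open Summit.Ventures.Crystal3D.Cruxes.TextureLiminf.TexShadow (E3)
open Literature.MathematicalPhysics.StatisticalMechanics (fccStacking barlowStacking IsHaggSeq)

/-- **Chimera inequality for inclined lamellae with per-lamella quantile windows.**  See the module
docstring.  The bodies `K_f` are arbitrary compact sets; `θ_f ≥ 0`, `Σ θ_f = 1`, `θ_f·V ≤ |E ∩ slab_f|`,
`θ_f·32 ≤ |K_f ∩ {lo_f < ⟪·,n⟫ < hi_f}|`. -/
theorem inclined_chimera_lower (n : E3) (hn : ‖n‖ = 1)
    {k : ℕ} (a : Fin (k + 1) → ℝ)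
    (E : Set E3) (hE : MeasurableSet E) (K : Fin k → Set E3) (hK : ∀ f, IsCompact (K f))
    {r : ℝ} (hr : 0 < r) {C : Set E3} (hC : MeasurableSet C)
    (hsub : ∀ f, ∀ x ∈ E ∩ {x : E3 | a f.castSucc < ⟪x, n⟫_ℝ ∧ ⟪x, n⟫_ℝ < a f.succ},
      ∀ w ∈ K f, x + r • w ∈ C)
    (θ : Fin k → ℝ) (hθ0 : ∀ f, 0 ≤ θ f) (hθ1 : ∑ f, θ f = 1)
    {V : ℝ} (hV : 0 < V)
    (hθV : ∀ f, ENNReal.ofReal (θ f * V) ≤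
      volume (E ∩ {x : E3 | a f.castSucc < ⟪x, n⟫_ℝ ∧ ⟪x, n⟫_ℝ < a f.succ}))
    (lo hi : Fin k → ℝ)
    (hq : ∀ f, ENNReal.ofReal (θ f * 32) ≤ volume (K f ∩ {y : E3 | lo f < ⟪y, n⟫_ℝ ∧ ⟪y, n⟫_ℝ < hi f})) :
    ENNReal.ofReal ((V ^ ((3 : ℝ)⁻¹) + r * (32 : ℝ) ^ ((3 : ℝ)⁻¹)) ^ 3) ≤
      ∑ f, volume (C ∩ {x : E3 | a f.castSucc + r * lo f < ⟪x, n⟫_ℝ ∧ ⟪x, n⟫_ℝ < a f.succ + r * hi f}) := by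
  classical
  set e₂ : E3 := EuclideanSpace.single (2 : Fin 3) (1 : ℝ) with he₂
  set slab : Fin k → Set E3 := fun f => {x : E3 | a f.castSucc < ⟪x, n⟫_ℝ ∧ ⟪x, n⟫_ℝ < a f.succ}
    with hslab
  set E' : Set E3 := ⋃ f : Fin k, E ∩ slab f with hE'
  have he : ‖e₂‖ = 1 := by rw [he₂, PiLp.norm_single, norm_one]
  -- a frame `L₀` with `L₀ e₂ = n` and the transport `T = coords ∘ L₀⁻¹`
  set L₀ : E3 ≃ₗᵢ[ℝ] E3 := (ℝ ∙ (e₂ - n))ᗮ.reflection with hL₀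
  have hL₀n : L₀ e₂ = n := Submodule.reflection_sub (by rw [he, hn])
  have hL₀symm : L₀.symm n = e₂ := by rw [← hL₀n, LinearIsometryEquiv.symm_apply_apply]
  set meq : E3 ≃ᵐ (Fin 3 → ℝ) := (MeasurableEquiv.toLp 2 (Fin 3 → ℝ)).symm with hmeq
  set T : E3 ≃ᵐ (Fin 3 → ℝ) := L₀.symm.toHomeomorph.toMeasurableEquiv.trans meq with hT
  have hTapply : ∀ x, T x = meq (L₀.symm x) := fun x => rfl
  have hTmp : MeasurePreserving T volume volume :=
    L₀.symm.measurePreserving.trans (EuclideanSpace.volume_preserving_symm_measurableEquiv_toLp (Fin 3))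
  have hTvol : ∀ X : Set E3, MeasurableSet X → volume (T '' X) = volume X := fun X hX => by
    rw [MeasurableEquiv.image_eq_preimage_symm]
    exact hTmp.symm.measure_preimage hX.nullMeasurableSet
  have hT2 : ∀ x : E3, (T x) 2 = ⟪x, n⟫_ℝ := by
    intro x
    rw [hTapply]
    show (L₀.symm x) 2 = ⟪x, n⟫_ℝ
    have h1 : (L₀.symm x) 2 = ⟪L₀.symm x, e₂⟫_ℝ := by
      rw [he₂, EuclideanSpace.inner_single_right]; simp
    rw [h1, ← hL₀symm, LinearIsometryEquiv.inner_map_map]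
  have hTadd : ∀ x y : E3, T (x + y) = T x + T y := fun x y => by
    rw [hTapply, hTapply, hTapply, map_add]; rfl
  have hmemT : ∀ (X : Set E3) (z : Fin 3 → ℝ), z ∈ T '' X ↔ T.symm z ∈ X := by
    intro X z
    rw [MeasurableEquiv.image_eq_preimage_symm, mem_preimage]
  -- measurability
  have hslabm : ∀ f, MeasurableSet (slab f) := fun f =>
    (continuous_id.inner continuous_const).measurable (measurableSet_Ioo (a := a f.castSucc) (b := a f.succ))
  have hE'm : MeasurableSet E' := MeasurableSet.iUnion fun f => hE.inter (hslabm f)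
  have hKm : ∀ f, MeasurableSet (r • K f) := fun f => ((hK f).smul r).isClosed.measurableSet
  -- the data of the runs engine
  set I : Fin k → Set ℝ := fun f => Ioo (a f.castSucc) (a f.succ) with hI
  set J : Fin k → Set ℝ := fun f => Ioo (r * lo f) (r * hi f) with hJ
  set Z : Fin k → Set ℝ := fun f => Ioo (a f.castSucc + r * lo f) (a f.succ + r * hi f) with hZ
  set Wt : Fin k → Set (Fin 3 → ℝ) := fun f => T '' (r • K f) with hWt
  have hIJZ : ∀ f, I f + J f ⊆ Z f := by
    rintro f _ ⟨t, ht, u, hu, rfl⟩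
    exact ⟨add_lt_add ht.1 hu.1, add_lt_add ht.2 hu.2⟩
  -- volumes
  set av : ℝ := V ^ ((3 : ℝ)⁻¹) with hav
  set bv : ℝ := r * (32 : ℝ) ^ ((3 : ℝ)⁻¹) with hbv
  have hav0 : 0 < av := Real.rpow_pos_of_pos hV _
  have hbv0 : 0 < bv := by positivity
  have hav3 : av ^ 3 = V := by
    rw [hav, show ((3 : ℝ)⁻¹) = ((3 : ℕ) : ℝ)⁻¹ by norm_num]
    exact Real.rpow_inv_natCast_pow hV.le (by norm_num)
  have hbv3 : bv ^ 3 = r ^ 3 * 32 := by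
    rw [hbv, mul_pow, show ((3 : ℝ)⁻¹) = ((3 : ℕ) : ℝ)⁻¹ by norm_num,
      Real.rpow_inv_natCast_pow (by norm_num : (0:ℝ) ≤ 32) (by norm_num)]
  have hvA : ∀ f, ENNReal.ofReal (θ f * av ^ 3) ≤ volume (T '' E' ∩ {x : Fin 3 → ℝ | x 2 ∈ I f}) := by
    intro f
    rw [hav3]
    refine (hθV f).trans ?_
    rw [← hTvol _ (hE.inter (hslabm f))]
    refine measure_mono ?_
    rintro _ ⟨x, hx, rfl⟩
    refine ⟨⟨x, mem_iUnion.2 ⟨f, hx⟩, rfl⟩, ?_⟩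
    show (T x) 2 ∈ I f
    rw [hT2]; exact hx.2
  have hvW : ∀ f, ENNReal.ofReal (θ f * bv ^ 3) ≤ volume (Wt f ∩ {x : Fin 3 → ℝ | x 2 ∈ J f}) := by
    intro f
    have hwin : MeasurableSet (K f ∩ {y : E3 | lo f < ⟪y, n⟫_ℝ ∧ ⟪y, n⟫_ℝ < hi f}) :=
      (hK f).isClosed.measurableSet.inter
        ((continuous_id.inner continuous_const).measurable (measurableSet_Ioo (a := lo f) (b := hi f)))
    have h1 : ENNReal.ofReal (θ f * bv ^ 3) ≤
        volume (T '' (r • (K f ∩ {y : E3 | lo f < ⟪y, n⟫_ℝ ∧ ⟪y, n⟫_ℝ < hi f}))) := by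
      rw [hTvol _ ((hwin.const_smul₀ r)), Measure.addHaar_smul, finrank_euclideanSpace,
        Fintype.card_fin, abs_of_pos (pow_pos hr 3), hbv3, show θ f * (r ^ 3 * 32) = r ^ 3 * (θ f * 32) by ring,
        ENNReal.ofReal_mul (pow_nonneg hr.le 3)]
      gcongr
      exact hq f
    refine h1.trans (measure_mono ?_)
    rintro _ ⟨_, ⟨y, ⟨hyK, hylo, hyhi⟩, rfl⟩, rfl⟩
    refine ⟨⟨r • y, Set.smul_mem_smul_set hyK, rfl⟩, ?_⟩
    show (T (r • y)) 2 ∈ J f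
    rw [hT2, real_inner_smul_left]
    exact ⟨mul_lt_mul_of_pos_left hylo hr, mul_lt_mul_of_pos_left hyhi hr⟩
  have hsub' : ∀ f, ∀ x ∈ T '' E', x 2 ∈ I f → ∀ w ∈ Wt f, w 2 ∈ J f → x + w ∈ T '' C := by
    rintro f _ ⟨e, he', rfl⟩ hxI _ ⟨_, ⟨y, hy, rfl⟩, rfl⟩ -
    have heE : e ∈ E := by
      obtain ⟨g, hg⟩ := mem_iUnion.1 he'
      exact hg.1
    have heI : e ∈ E ∩ slab f := ⟨heE, by
      show a f.castSucc < ⟪e, n⟫_ℝ ∧ ⟪e, n⟫_ℝ < a f.succ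
      rw [← hT2]; exact hxI⟩
    refine ⟨e + r • y, hsub f e heI y hy, ?_⟩
    rw [hTadd]
  have hruns := Chimera.chimera3_runs_pow I J Z Wt
    ((MeasurableEquiv.measurableSet_image _).2 hE'm) ((MeasurableEquiv.measurableSet_image _).2 hC)
    (fun f => (MeasurableEquiv.measurableSet_image _).2 (hKm f))
    (fun f => measurableSet_Ioo) (fun f => measurableSet_Ioo) (fun f => measurableSet_Ioo)
    hIJZ hsub' θ hθ0 hθ1 hav0 hbv0 hvA hvW
  -- read off: `T '' C ∩ {x₂ ∈ Z f} = T '' (C ∩ window f)`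
  have hwin : ∀ f, volume (T '' C ∩ {x : Fin 3 → ℝ | x 2 ∈ Z f}) =
      volume (C ∩ {x : E3 | a f.castSucc + r * lo f < ⟪x, n⟫_ℝ ∧ ⟪x, n⟫_ℝ < a f.succ + r * hi f}) := by
    intro f
    have hm : MeasurableSet (C ∩ {x : E3 | a f.castSucc + r * lo f < ⟪x, n⟫_ℝ ∧ ⟪x, n⟫_ℝ < a f.succ + r * hi f}) :=
      hC.inter ((continuous_id.inner continuous_const).measurable
        (measurableSet_Ioo (a := a f.castSucc + r * lo f) (b := a f.succ + r * hi f)))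
    rw [← hTvol _ hm]
    congr 1
    ext z
    simp only [mem_inter_iff, mem_setOf_eq, hmemT]
    constructor
    · rintro ⟨hz, hzZ⟩
      refine ⟨hz, ?_⟩
      have := hT2 (T.symm z)
      rw [T.apply_symm_apply] at this
      rw [← this]; exact hzZ
    · rintro ⟨hz, hzZ⟩
      refine ⟨hz, ?_⟩
      have := hT2 (T.symm z)
      rw [T.apply_symm_apply] at this
      rw [this]; exact hzZ
  simp_rw [hwin] at hruns
  exact hruns

/-- **Chimera inequality for inclined lamellae with per-lamella quantile windows, arbitrary height
intervals** `(α_f, β_f)` (not necessarily adjacent — GAPS between lamellae are allowed; this is how a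
consumer separates consecutive windows).  See the module docstring.  The bodies `K_f` are arbitrary compact sets; `θ_f ≥ 0`, `Σ θ_f = 1`, `θ_f·V ≤ |E ∩ slab_f|`,
`θ_f·32 ≤ |K_f ∩ {lo_f < ⟪·,n⟫ < hi_f}|`. -/
theorem inclined_chimera_lower' (n : E3) (hn : ‖n‖ = 1)
    {k : ℕ} (α β : Fin k → ℝ)
    (E : Set E3) (hE : MeasurableSet E) (K : Fin k → Set E3) (hK : ∀ f, IsCompact (K f))
    {r : ℝ} (hr : 0 < r) {C : Set E3} (hC : MeasurableSet C)
    (hsub : ∀ f, ∀ x ∈ E ∩ {x : E3 | α f < ⟪x, n⟫_ℝ ∧ ⟪x, n⟫_ℝ < β f},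
      ∀ w ∈ K f, x + r • w ∈ C)
    (θ : Fin k → ℝ) (hθ0 : ∀ f, 0 ≤ θ f) (hθ1 : ∑ f, θ f = 1)
    {V : ℝ} (hV : 0 < V)
    (hθV : ∀ f, ENNReal.ofReal (θ f * V) ≤
      volume (E ∩ {x : E3 | α f < ⟪x, n⟫_ℝ ∧ ⟪x, n⟫_ℝ < β f}))
    (lo hi : Fin k → ℝ)
    (hq : ∀ f, ENNReal.ofReal (θ f * 32) ≤ volume (K f ∩ {y : E3 | lo f < ⟪y, n⟫_ℝ ∧ ⟪y, n⟫_ℝ < hi f})) :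
    ENNReal.ofReal ((V ^ ((3 : ℝ)⁻¹) + r * (32 : ℝ) ^ ((3 : ℝ)⁻¹)) ^ 3) ≤
      ∑ f, volume (C ∩ {x : E3 | α f + r * lo f < ⟪x, n⟫_ℝ ∧ ⟪x, n⟫_ℝ < β f + r * hi f}) := by
  classical
  set e₂ : E3 := EuclideanSpace.single (2 : Fin 3) (1 : ℝ) with he₂
  set slab : Fin k → Set E3 := fun f => {x : E3 | α f < ⟪x, n⟫_ℝ ∧ ⟪x, n⟫_ℝ < β f}
    with hslab
  set E' : Set E3 := ⋃ f : Fin k, E ∩ slab f with hE'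
  have he : ‖e₂‖ = 1 := by rw [he₂, PiLp.norm_single, norm_one]
  -- a frame `L₀` with `L₀ e₂ = n` and the transport `T = coords ∘ L₀⁻¹`
  set L₀ : E3 ≃ₗᵢ[ℝ] E3 := (ℝ ∙ (e₂ - n))ᗮ.reflection with hL₀
  have hL₀n : L₀ e₂ = n := Submodule.reflection_sub (by rw [he, hn])
  have hL₀symm : L₀.symm n = e₂ := by rw [← hL₀n, LinearIsometryEquiv.symm_apply_apply]
  set meq : E3 ≃ᵐ (Fin 3 → ℝ) := (MeasurableEquiv.toLp 2 (Fin 3 → ℝ)).symm with hmeq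
  set T : E3 ≃ᵐ (Fin 3 → ℝ) := L₀.symm.toHomeomorph.toMeasurableEquiv.trans meq with hT
  have hTapply : ∀ x, T x = meq (L₀.symm x) := fun x => rfl
  have hTmp : MeasurePreserving T volume volume :=
    L₀.symm.measurePreserving.trans (EuclideanSpace.volume_preserving_symm_measurableEquiv_toLp (Fin 3))
  have hTvol : ∀ X : Set E3, MeasurableSet X → volume (T '' X) = volume X := fun X hX => by
    rw [MeasurableEquiv.image_eq_preimage_symm]
    exact hTmp.symm.measure_preimage hX.nullMeasurableSet
  have hT2 : ∀ x : E3, (T x) 2 = ⟪x, n⟫_ℝ := by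
    intro x
    rw [hTapply]
    show (L₀.symm x) 2 = ⟪x, n⟫_ℝ
    have h1 : (L₀.symm x) 2 = ⟪L₀.symm x, e₂⟫_ℝ := by
      rw [he₂, EuclideanSpace.inner_single_right]; simp
    rw [h1, ← hL₀symm, LinearIsometryEquiv.inner_map_map]
  have hTadd : ∀ x y : E3, T (x + y) = T x + T y := fun x y => by
    rw [hTapply, hTapply, hTapply, map_add]; rfl
  have hmemT : ∀ (X : Set E3) (z : Fin 3 → ℝ), z ∈ T '' X ↔ T.symm z ∈ X := by
    intro X z
    rw [MeasurableEquiv.image_eq_preimage_symm, mem_preimage]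
  -- measurability
  have hslabm : ∀ f, MeasurableSet (slab f) := fun f =>
    (continuous_id.inner continuous_const).measurable (measurableSet_Ioo (a := α f) (b := β f))
  have hE'm : MeasurableSet E' := MeasurableSet.iUnion fun f => hE.inter (hslabm f)
  have hKm : ∀ f, MeasurableSet (r • K f) := fun f => ((hK f).smul r).isClosed.measurableSet
  -- the data of the runs engine
  set I : Fin k → Set ℝ := fun f => Ioo (α f) (β f) with hI
  set J : Fin k → Set ℝ := fun f => Ioo (r * lo f) (r * hi f) with hJ
  set Z : Fin k → Set ℝ := fun f => Ioo (α f + r * lo f) (β f + r * hi f) with hZ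
  set Wt : Fin k → Set (Fin 3 → ℝ) := fun f => T '' (r • K f) with hWt
  have hIJZ : ∀ f, I f + J f ⊆ Z f := by
    rintro f _ ⟨t, ht, u, hu, rfl⟩
    exact ⟨add_lt_add ht.1 hu.1, add_lt_add ht.2 hu.2⟩
  -- volumes
  set av : ℝ := V ^ ((3 : ℝ)⁻¹) with hav
  set bv : ℝ := r * (32 : ℝ) ^ ((3 : ℝ)⁻¹) with hbv
  have hav0 : 0 < av := Real.rpow_pos_of_pos hV _
  have hbv0 : 0 < bv := by positivity
  have hav3 : av ^ 3 = V := by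
    rw [hav, show ((3 : ℝ)⁻¹) = ((3 : ℕ) : ℝ)⁻¹ by norm_num]
    exact Real.rpow_inv_natCast_pow hV.le (by norm_num)
  have hbv3 : bv ^ 3 = r ^ 3 * 32 := by
    rw [hbv, mul_pow, show ((3 : ℝ)⁻¹) = ((3 : ℕ) : ℝ)⁻¹ by norm_num,
      Real.rpow_inv_natCast_pow (by norm_num : (0:ℝ) ≤ 32) (by norm_num)]
  have hvA : ∀ f, ENNReal.ofReal (θ f * av ^ 3) ≤ volume (T '' E' ∩ {x : Fin 3 → ℝ | x 2 ∈ I f}) := by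
    intro f
    rw [hav3]
    refine (hθV f).trans ?_
    rw [← hTvol _ (hE.inter (hslabm f))]
    refine measure_mono ?_
    rintro _ ⟨x, hx, rfl⟩
    refine ⟨⟨x, mem_iUnion.2 ⟨f, hx⟩, rfl⟩, ?_⟩
    show (T x) 2 ∈ I f
    rw [hT2]; exact hx.2
  have hvW : ∀ f, ENNReal.ofReal (θ f * bv ^ 3) ≤ volume (Wt f ∩ {x : Fin 3 → ℝ | x 2 ∈ J f}) := by
    intro f
    have hwin : MeasurableSet (K f ∩ {y : E3 | lo f < ⟪y, n⟫_ℝ ∧ ⟪y, n⟫_ℝ < hi f}) :=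
      (hK f).isClosed.measurableSet.inter
        ((continuous_id.inner continuous_const).measurable (measurableSet_Ioo (a := lo f) (b := hi f)))
    have h1 : ENNReal.ofReal (θ f * bv ^ 3) ≤
        volume (T '' (r • (K f ∩ {y : E3 | lo f < ⟪y, n⟫_ℝ ∧ ⟪y, n⟫_ℝ < hi f}))) := by
      rw [hTvol _ ((hwin.const_smul₀ r)), Measure.addHaar_smul, finrank_euclideanSpace,
        Fintype.card_fin, abs_of_pos (pow_pos hr 3), hbv3, show θ f * (r ^ 3 * 32) = r ^ 3 * (θ f * 32) by ring,
        ENNReal.ofReal_mul (pow_nonneg hr.le 3)]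
      gcongr
      exact hq f
    refine h1.trans (measure_mono ?_)
    rintro _ ⟨_, ⟨y, ⟨hyK, hylo, hyhi⟩, rfl⟩, rfl⟩
    refine ⟨⟨r • y, Set.smul_mem_smul_set hyK, rfl⟩, ?_⟩
    show (T (r • y)) 2 ∈ J f
    rw [hT2, real_inner_smul_left]
    exact ⟨mul_lt_mul_of_pos_left hylo hr, mul_lt_mul_of_pos_left hyhi hr⟩
  have hsub' : ∀ f, ∀ x ∈ T '' E', x 2 ∈ I f → ∀ w ∈ Wt f, w 2 ∈ J f → x + w ∈ T '' C := by
    rintro f _ ⟨e, he', rfl⟩ hxI _ ⟨_, ⟨y, hy, rfl⟩, rfl⟩ -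
    have heE : e ∈ E := by
      obtain ⟨g, hg⟩ := mem_iUnion.1 he'
      exact hg.1
    have heI : e ∈ E ∩ slab f := ⟨heE, by
      show α f < ⟪e, n⟫_ℝ ∧ ⟪e, n⟫_ℝ < β f
      rw [← hT2]; exact hxI⟩
    refine ⟨e + r • y, hsub f e heI y hy, ?_⟩
    rw [hTadd]
  have hruns := Chimera.chimera3_runs_pow I J Z Wt
    ((MeasurableEquiv.measurableSet_image _).2 hE'm) ((MeasurableEquiv.measurableSet_image _).2 hC)
    (fun f => (MeasurableEquiv.measurableSet_image _).2 (hKm f))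
    (fun f => measurableSet_Ioo) (fun f => measurableSet_Ioo) (fun f => measurableSet_Ioo)
    hIJZ hsub' θ hθ0 hθ1 hav0 hbv0 hvA hvW
  -- read off: `T '' C ∩ {x₂ ∈ Z f} = T '' (C ∩ window f)`
  have hwin : ∀ f, volume (T '' C ∩ {x : Fin 3 → ℝ | x 2 ∈ Z f}) =
      volume (C ∩ {x : E3 | α f + r * lo f < ⟪x, n⟫_ℝ ∧ ⟪x, n⟫_ℝ < β f + r * hi f}) := by
    intro f
    have hm : MeasurableSet (C ∩ {x : E3 | α f + r * lo f < ⟪x, n⟫_ℝ ∧ ⟪x, n⟫_ℝ < β f + r * hi f}) :=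
      hC.inter ((continuous_id.inner continuous_const).measurable
        (measurableSet_Ioo (a := α f + r * lo f) (b := β f + r * hi f)))
    rw [← hTvol _ hm]
    congr 1
    ext z
    simp only [mem_inter_iff, mem_setOf_eq, hmemT]
    constructor
    · rintro ⟨hz, hzZ⟩
      refine ⟨hz, ?_⟩
      have := hT2 (T.symm z)
      rw [T.apply_symm_apply] at this
      rw [← this]; exact hzZ
    · rintro ⟨hz, hzZ⟩
      refine ⟨hz, ?_⟩
      have := hT2 (T.symm z)
      rw [T.apply_symm_apply] at this
      rw [this]; exact hzZ
  simp_rw [hwin] at hruns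
  exact hruns


/-- **Disjoint windows.**  In `inclined_chimera_lower'`, if the windows
`(α_f + r·lo_f, β_f + r·hi_f)` are pairwise disjoint, the right-hand side is at most `|C|`:
`(V^{1/3} + r·32^{1/3})³ ≤ |C|` — the plain Brunn–Minkowski conclusion for lamellae separated by gaps
absorbing the quantile mismatch of consecutive bodies. -/
theorem inclined_chimera_lower_of_disjoint (n : E3) (hn : ‖n‖ = 1)
    {k : ℕ} (α β : Fin k → ℝ)
    (E : Set E3) (hE : MeasurableSet E) (K : Fin k → Set E3) (hK : ∀ f, IsCompact (K f))
    {r : ℝ} (hr : 0 < r) {C : Set E3} (hC : MeasurableSet C)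
    (hsub : ∀ f, ∀ x ∈ E ∩ {x : E3 | α f < ⟪x, n⟫_ℝ ∧ ⟪x, n⟫_ℝ < β f},
      ∀ w ∈ K f, x + r • w ∈ C)
    (θ : Fin k → ℝ) (hθ0 : ∀ f, 0 ≤ θ f) (hθ1 : ∑ f, θ f = 1)
    {V : ℝ} (hV : 0 < V)
    (hθV : ∀ f, ENNReal.ofReal (θ f * V) ≤
      volume (E ∩ {x : E3 | α f < ⟪x, n⟫_ℝ ∧ ⟪x, n⟫_ℝ < β f}))
    (lo hi : Fin k → ℝ)
    (hq : ∀ f, ENNReal.ofReal (θ f * 32) ≤ volume (K f ∩ {y : E3 | lo f < ⟪y, n⟫_ℝ ∧ ⟪y, n⟫_ℝ < hi f}))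
    (hdisj : ∀ f g, f ≠ g → Disjoint (Set.Ioo (α f + r * lo f) (β f + r * hi f))
      (Set.Ioo (α g + r * lo g) (β g + r * hi g))) :
    ENNReal.ofReal ((V ^ ((3 : ℝ)⁻¹) + r * (32 : ℝ) ^ ((3 : ℝ)⁻¹)) ^ 3) ≤ volume C := by
  refine (inclined_chimera_lower' n hn α β E hE K hK hr hC hsub θ hθ0 hθ1 hV hθV lo hi hq).trans ?_
  have hm : ∀ f, MeasurableSet (C ∩ {x : E3 | α f + r * lo f < ⟪x, n⟫_ℝ ∧ ⟪x, n⟫_ℝ < β f + r * hi f}) :=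
    fun f => hC.inter ((continuous_id.inner continuous_const).measurable
      (measurableSet_Ioo (a := α f + r * lo f) (b := β f + r * hi f)))
  rw [← measure_biUnion_finset (fun f _ g _ hfg => ?_) (fun f _ => hm f)]
  · exact measure_mono (Set.iUnion₂_subset fun f _ => Set.inter_subset_left)
  · show Disjoint (C ∩ _) (C ∩ _)
    rw [Set.disjoint_left]
    rintro x ⟨-, hxf⟩ ⟨-, hxg⟩
    exact Set.disjoint_left.1 (hdisj f g hfg) hxf hxg
end Summit.Ventures.Crystal3D.Theorems

end
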